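import Summits.NavierStokesRegularity.NavierStokesRegularity.Theorems.RellichScarScarRigidityVorticityDefectIBP
import Summits.NavierStokesRegularity.NavierStokesRegularity.Theorems.RellichScarScarRigidityApexRegularityKernel
import HarnessLib

/-!
# `ScarRigidity`, line `moment-conditioned-rellich` — stub `stub_biotSavartFarField` (BS), part 4:
# the Laplacian of a divergence-free field through its antisymmetric gradient

Crux stmt-NavierStokesRegularity-11717 (route RellichScar), helper file (`--supports`) for the registered stub
`stub_biotSavartFarField` (skeleton `Cruxes/ScarRigidity/Lines/moment_conditioned_rellich.lean`).

For a smooth field `w : ℝ³ → ℝ³` write `A_ij(y) = ∂ᵢw_j(y) − ∂ⱼw_i(y) = (Dw(y)eᵢ)_j − (Dw(y)eⱼ)_i`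
(`eᵢ = EuclideanSpace.single i 1`, the skeleton's spelling).  This file is the pointwise calculus:

* `fderiv_antisymGrad_apply` — `∂ᵥA_ij = (D²w(v, eᵢ))_j − (D²w(v, eⱼ))_i`, and the cyclic (Bianchi) identity
  `∂_lA_mj + ∂_mA_jl + ∂_jA_lm = 0` (`antisymGrad_cyclic`, symmetry of `D²w`);
* **`(Δw)_j = Σᵢ ∂ᵢA_ij` for divergence-free `w`** (`laplacian_coord_eq_sum_fderiv_antisymGrad`:
  `Σᵢ ∂ᵢ∂ⱼwᵢ = ∂ⱼ div w = 0`);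
* consequently `‖Dⁿ(Δw)(y)‖ ≤ Σ_{ij} ‖Dⁿ⁺¹A_ij(y)‖` (`norm_iteratedFDeriv_laplacian_le_sum`), through the
  component bound `‖DⁿG(y)‖ ≤ Σ_j ‖DⁿG_j(y)‖` (`norm_iteratedFDeriv_le_sum_coord`).
-/

noncomputable section

open Set Filter Function MeasureTheory Metric TopologicalSpace
open scoped Topology ContDiff Laplacian InnerProductSpace RealInnerProductSpace

set_option linter.dupNamespace false -- D-0017: `Summit.<S>.<S>.…` repeats the summit name by design

-- nested operator types (`ℝ³ →L[ℝ] ℝ³ →L[ℝ] ℝ³`)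
set_option maxSynthPendingDepth 4

namespace Summit.NavierStokesRegularity.NavierStokesRegularity.Theorems.RellichScarScarRigidity

open Literature.Analysis.FluidPDE

variable {w : EuclideanSpace ℝ (Fin 3) → EuclideanSpace ℝ (Fin 3)}

/-! ### Second derivatives -/

/-- `∂ᵥ(z ↦ Dw(z) u)(y) = D²w(y)(v)(u)` for `w ∈ C²`. [folklore] -/
theorem fderiv_fderiv_apply_const' {V : Type*} [NormedAddCommGroup V] [NormedSpace ℝ V]
    {f : EuclideanSpace ℝ (Fin 3) → V} (hf : ContDiff ℝ 2 f) (y u v : EuclideanSpace ℝ (Fin 3)) :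
    fderiv ℝ (fun z => fderiv ℝ f z u) y v = fderiv ℝ (fderiv ℝ f) y v u := by
  have hd : DifferentiableAt ℝ (fderiv ℝ f) y :=
    ((hf.fderiv_right (m := 1) le_rfl).differentiable one_ne_zero) y
  rw [fderiv_clm_apply hd (differentiableAt_const u)]
  simp

/-- `z ↦ Dw(z) u` is `C¹` for `w ∈ C²`. [folklore] -/
theorem contDiff_one_fderiv_apply_const (hw : ContDiff ℝ 2 w) (u : EuclideanSpace ℝ (Fin 3)) :
    ContDiff ℝ 1 fun z => fderiv ℝ w z u :=
  (hw.fderiv_right (m := 1) le_rfl).clm_apply contDiff_const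

/-- **`∂ᵥA_ij(y) = (D²w(y)(v, eᵢ))_j − (D²w(y)(v, eⱼ))_i`** for `w ∈ C²`. [folklore] -/
theorem fderiv_antisymGrad_apply (hw : ContDiff ℝ 2 w) (i j : Fin 3) (y v : EuclideanSpace ℝ (Fin 3)) :
    fderiv ℝ (fun z => (fderiv ℝ w z (EuclideanSpace.single i (1 : ℝ))) j -
        (fderiv ℝ w z (EuclideanSpace.single j (1 : ℝ))) i) y v =
      (fderiv ℝ (fderiv ℝ w) y v (EuclideanSpace.single i (1 : ℝ))) j -
        (fderiv ℝ (fderiv ℝ w) y v (EuclideanSpace.single j (1 : ℝ))) i := by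
  have hgi := contDiff_one_fderiv_apply_const hw (EuclideanSpace.single i (1 : ℝ))
  have hgj := contDiff_one_fderiv_apply_const hw (EuclideanSpace.single j (1 : ℝ))
  have hdi : DifferentiableAt ℝ (fun z => (fderiv ℝ w z (EuclideanSpace.single i (1 : ℝ))) j) y := by
    have := (EuclideanSpace.proj j).differentiableAt.comp y (hgi.differentiable one_ne_zero y)
    exact this
  have hdj : DifferentiableAt ℝ (fun z => (fderiv ℝ w z (EuclideanSpace.single j (1 : ℝ))) i) y := by
    have := (EuclideanSpace.proj i).differentiableAt.comp y (hgj.differentiable one_ne_zero y)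
    exact this
  rw [fderiv_fun_sub hdi hdj, FunLike.coe_sub, Pi.sub_apply,
    ← fderiv_apply_coord_eq (hgi.differentiable one_ne_zero y),
    ← fderiv_apply_coord_eq (hgj.differentiable one_ne_zero y),
    fderiv_fderiv_apply_const' hw, fderiv_fderiv_apply_const' hw]

/-- **The cyclic (Bianchi) identity** `∂_lA_mj + ∂_mA_jl + ∂_jA_lm = 0` for `w ∈ C²` (symmetry of the
Hessian). [folklore] -/
theorem antisymGrad_cyclic (hw : ContDiff ℝ 2 w) (l m j : Fin 3) (y : EuclideanSpace ℝ (Fin 3)) :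
    fderiv ℝ (fun z => (fderiv ℝ w z (EuclideanSpace.single m (1 : ℝ))) j -
        (fderiv ℝ w z (EuclideanSpace.single j (1 : ℝ))) m) y (EuclideanSpace.single l (1 : ℝ)) +
      fderiv ℝ (fun z => (fderiv ℝ w z (EuclideanSpace.single j (1 : ℝ))) l -
        (fderiv ℝ w z (EuclideanSpace.single l (1 : ℝ))) j) y (EuclideanSpace.single m (1 : ℝ)) +
      fderiv ℝ (fun z => (fderiv ℝ w z (EuclideanSpace.single l (1 : ℝ))) m -
        (fderiv ℝ w z (EuclideanSpace.single m (1 : ℝ))) l) y (EuclideanSpace.single j (1 : ℝ)) = 0 := by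
  have hS : IsSymmSndFDerivAt ℝ w y := (hw.contDiffAt (x := y)).isSymmSndFDerivAt (by simp)
  rw [fderiv_antisymGrad_apply hw, fderiv_antisymGrad_apply hw, fderiv_antisymGrad_apply hw,
    hS.eq (EuclideanSpace.single m (1 : ℝ)) (EuclideanSpace.single l (1 : ℝ)),
    hS.eq (EuclideanSpace.single j (1 : ℝ)) (EuclideanSpace.single l (1 : ℝ)),
    hS.eq (EuclideanSpace.single j (1 : ℝ)) (EuclideanSpace.single m (1 : ℝ))]
  ring

/-- Pointwise antisymmetry `A_ji = −A_ij`. [folklore] -/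
theorem antisymGrad_swap (i j : Fin 3) (y : EuclideanSpace ℝ (Fin 3)) :
    (fderiv ℝ w y (EuclideanSpace.single j (1 : ℝ))) i - (fderiv ℝ w y (EuclideanSpace.single i (1 : ℝ))) j =
      -((fderiv ℝ w y (EuclideanSpace.single i (1 : ℝ))) j - (fderiv ℝ w y (EuclideanSpace.single j (1 : ℝ))) i) := by
  ring

/-! ### The Laplacian through the antisymmetric gradient -/

/-- The divergence in coordinates: `div w (z) = Σᵢ (Dw(z) eᵢ)ᵢ`. [folklore] -/
theorem divergence_eq_sum_coord (z : EuclideanSpace ℝ (Fin 3)) :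
    VectorCalculus.divergence w z = ∑ i : Fin 3, (fderiv ℝ w z (EuclideanSpace.single i (1 : ℝ))) i := by
  rw [divergence_eq_sum_inner_fderiv (EuclideanSpace.basisFun (Fin 3) ℝ) w z]
  refine Finset.sum_congr rfl fun i _ => ?_
  rw [EuclideanSpace.basisFun_apply, EuclideanSpace.inner_single_left, map_one, one_mul]

/-- For a divergence-free `C²` field, `Σᵢ (D²w(y)(v, eᵢ))ᵢ = ∂ᵥ(div w)(y) = 0`. [folklore] -/
theorem sum_fderiv_fderiv_coord_eq_zero (hw : ContDiff ℝ 2 w) (hdiv : VectorCalculus.IsDivFree w)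
    (y v : EuclideanSpace ℝ (Fin 3)) :
    ∑ i : Fin 3, (fderiv ℝ (fderiv ℝ w) y v (EuclideanSpace.single i (1 : ℝ))) i = 0 := by
  have hg : ∀ i : Fin 3, DifferentiableAt ℝ
      (fun z => (fderiv ℝ w z (EuclideanSpace.single i (1 : ℝ))) i) y := fun i => by
    have := (EuclideanSpace.proj i).differentiableAt.comp y
      ((contDiff_one_fderiv_apply_const hw (EuclideanSpace.single i (1 : ℝ))).differentiable one_ne_zero y)
    exact this
  have h0 : (fun z => ∑ i : Fin 3, (fderiv ℝ w z (EuclideanSpace.single i (1 : ℝ))) i) = fun _ => (0 : ℝ) := by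
    funext z
    rw [← divergence_eq_sum_coord]
    exact hdiv z
  have h1 : fderiv ℝ (fun z => ∑ i : Fin 3, (fderiv ℝ w z (EuclideanSpace.single i (1 : ℝ))) i) y v = 0 := by
    rw [h0, fderiv_const_apply, FunLike.coe_zero, Pi.zero_apply]
  rw [fderiv_fun_sum fun i _ => hg i, FunLike.coe_sum, Finset.sum_apply] at h1
  rw [← h1]
  refine Finset.sum_congr rfl fun i _ => ?_
  rw [← fderiv_apply_coord_eq ((contDiff_one_fderiv_apply_const hw _).differentiable one_ne_zero y),
    fderiv_fderiv_apply_const' hw]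

/-- **`(Δw)_j = Σᵢ ∂ᵢA_ij`** for a divergence-free `C²` field `w` on `ℝ³`:
`Σᵢ ∂ᵢ(∂ᵢw_j − ∂ⱼw_i) = Δw_j − ∂ⱼ div w`. [folklore] -/
theorem laplacian_coord_eq_sum_fderiv_antisymGrad (hw : ContDiff ℝ 2 w) (hdiv : VectorCalculus.IsDivFree w)
    (y : EuclideanSpace ℝ (Fin 3)) (j : Fin 3) :
    (Δ w y) j = ∑ i : Fin 3, fderiv ℝ (fun z => (fderiv ℝ w z (EuclideanSpace.single i (1 : ℝ))) j -
      (fderiv ℝ w z (EuclideanSpace.single j (1 : ℝ))) i) y (EuclideanSpace.single i (1 : ℝ)) := by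
  have hS : IsSymmSndFDerivAt ℝ w y := (hw.contDiffAt (x := y)).isSymmSndFDerivAt (by simp)
  simp_rw [fderiv_antisymGrad_apply hw, Finset.sum_sub_distrib]
  have h2 : ∑ i : Fin 3, (fderiv ℝ (fderiv ℝ w) y (EuclideanSpace.single i (1 : ℝ))
      (EuclideanSpace.single j (1 : ℝ))) i = 0 := by
    simp_rw [hS.eq _ (EuclideanSpace.single j (1 : ℝ))]
    exact sum_fderiv_fderiv_coord_eq_zero hw hdiv y _
  rw [h2, sub_zero, laplacian_eq_sum_fderiv_fderiv (EuclideanSpace.basisFun (Fin 3) ℝ) hw y,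
    WithLp.ofLp_sum, Finset.sum_apply]
  refine Finset.sum_congr rfl fun i _ => ?_
  rw [EuclideanSpace.basisFun_apply, fderiv_fderiv_apply_const' hw]

/-! ### Norms of iterated derivatives through components -/

/-- `‖v‖ ≤ Σ_j |v_j|` on `ℝ³`. [folklore] -/
theorem norm_le_sum_abs_coord (v : EuclideanSpace ℝ (Fin 3)) : ‖v‖ ≤ ∑ j : Fin 3, |v j| := by
  conv_lhs => rw [← (EuclideanSpace.basisFun (Fin 3) ℝ).sum_repr v]
  refine (norm_sum_le _ _).trans (Finset.sum_le_sum fun j _ => ?_)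
  rw [EuclideanSpace.basisFun_repr, EuclideanSpace.basisFun_apply, norm_smul, Real.norm_eq_abs]
  simp

/-- **Component bound for iterated derivatives**: `‖DⁿG(y)‖ ≤ Σ_j ‖Dⁿ(G_j)(y)‖` for `G ∈ Cⁿ(ℝ³; ℝ³)`. [folklore] -/
theorem norm_iteratedFDeriv_le_sum_coord {G : EuclideanSpace ℝ (Fin 3) → EuclideanSpace ℝ (Fin 3)} {n : ℕ}
    (hG : ContDiff ℝ n G) (y : EuclideanSpace ℝ (Fin 3)) :
    ‖iteratedFDeriv ℝ n G y‖ ≤ ∑ j : Fin 3, ‖iteratedFDeriv ℝ n (fun z => G z j) y‖ := by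
  refine ContinuousMultilinearMap.opNorm_le_bound (Finset.sum_nonneg fun j _ => norm_nonneg _) fun m => ?_
  rw [Finset.sum_mul]
  refine (norm_le_sum_abs_coord _).trans (Finset.sum_le_sum fun j _ => ?_)
  have e : (fun z => G z j) = (EuclideanSpace.proj j : EuclideanSpace ℝ (Fin 3) →L[ℝ] ℝ) ∘ G := rfl
  have h := (EuclideanSpace.proj j : EuclideanSpace ℝ (Fin 3) →L[ℝ] ℝ).iteratedFDeriv_comp_left
    (f := G) (x := y) hG.contDiffAt (i := n) le_rfl
  have happ : (iteratedFDeriv ℝ n G y m) j = iteratedFDeriv ℝ n (fun z => G z j) y m := by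
    rw [e, h]; rfl
  rw [← Real.norm_eq_abs, happ]
  exact ContinuousMultilinearMap.le_opNorm _ _

/-- **`‖Dⁿ(Δw)(y)‖ ≤ Σ_{ij} ‖Dⁿ⁺¹A_ij(y)‖`** for a smooth divergence-free field. [folklore] -/
theorem norm_iteratedFDeriv_laplacian_le_sum (hw : ContDiff ℝ ∞ w) (hdiv : VectorCalculus.IsDivFree w)
    (n : ℕ) (y : EuclideanSpace ℝ (Fin 3)) :
    ‖iteratedFDeriv ℝ n (Δ w) y‖ ≤ ∑ j : Fin 3, ∑ i : Fin 3,
      ‖iteratedFDeriv ℝ (n + 1) (fun z => (fderiv ℝ w z (EuclideanSpace.single i (1 : ℝ))) j -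
        (fderiv ℝ w z (EuclideanSpace.single j (1 : ℝ))) i) y‖ := by
  have hw2 : ContDiff ℝ 2 w := contDiff_infty.1 hw 2
  have hΔ : ContDiff ℝ n (Δ w) := contDiff_laplacian (n := n) (contDiff_infty.1 hw (n + 2))
  have hA : ∀ i j : Fin 3, ContDiff ℝ ∞ (fun z => (fderiv ℝ w z (EuclideanSpace.single i (1 : ℝ))) j -
      (fderiv ℝ w z (EuclideanSpace.single j (1 : ℝ))) i) := fun i j => contDiff_antisymGrad (n := ⊤) hw i j
  refine (norm_iteratedFDeriv_le_sum_coord hΔ y).trans (Finset.sum_le_sum fun j _ => ?_)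
  have e : (fun z => (Δ w z) j) = fun z => ∑ i : Fin 3,
      (fun i z => fderiv ℝ (fun z => (fderiv ℝ w z (EuclideanSpace.single i (1 : ℝ))) j -
        (fderiv ℝ w z (EuclideanSpace.single j (1 : ℝ))) i) z (EuclideanSpace.single i (1 : ℝ))) i z :=
    funext fun z => laplacian_coord_eq_sum_fderiv_antisymGrad hw2 hdiv z j
  have hAi : ∀ i : Fin 3, ContDiff ℝ n (fun z => fderiv ℝ (fun z =>
      (fderiv ℝ w z (EuclideanSpace.single i (1 : ℝ))) j - (fderiv ℝ w z (EuclideanSpace.single j (1 : ℝ))) i)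
        z (EuclideanSpace.single i (1 : ℝ))) := fun i =>
    (((hA i j).fderiv_right (m := ∞) le_rfl).clm_apply contDiff_const).of_le (by exact_mod_cast le_top)
  rw [e, iteratedFDeriv_sum fun i _ => hAi i, Finset.sum_apply]
  refine (norm_sum_le _ _).trans (Finset.sum_le_sum fun i _ => ?_)
  have hk : ContDiff ℝ (n + 1 : ℕ) (fun z => (fderiv ℝ w z (EuclideanSpace.single i (1 : ℝ))) j -
      (fderiv ℝ w z (EuclideanSpace.single j (1 : ℝ))) i) := (hA i j).of_le (by exact_mod_cast le_top)
  calc ‖iteratedFDeriv ℝ n (fun z => fderiv ℝ (fun z => (fderiv ℝ w z (EuclideanSpace.single i (1 : ℝ))) j -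
        (fderiv ℝ w z (EuclideanSpace.single j (1 : ℝ))) i) z (EuclideanSpace.single i (1 : ℝ))) y‖
      ≤ ‖(EuclideanSpace.single i (1 : ℝ) : EuclideanSpace ℝ (Fin 3))‖ *
          ‖iteratedFDeriv ℝ (n + 1) (fun z => (fderiv ℝ w z (EuclideanSpace.single i (1 : ℝ))) j -
            (fderiv ℝ w z (EuclideanSpace.single j (1 : ℝ))) i) y‖ :=
        norm_iteratedFDeriv_fderiv_apply_le_of_contDiff hk _ le_rfl y
    _ = _ := by simp

/-! ### Registered sub-goal -/

/-- **Registered helper stub `stub_biotSavartLaplacianTools`** of `stub_biotSavartFarField` (crux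
stmt-NavierStokesRegularity-11717, line `moment-conditioned-rellich`): `(Δw)_j = Σᵢ ∂ᵢA_ij` for divergence-free
fields, the cyclic identity of the antisymmetric gradient, and the component bound for the derivatives of `Δw`.
[folklore] -/
theorem stub_biotSavartLaplacianTools :
    (∀ (w : EuclideanSpace ℝ (Fin 3) → EuclideanSpace ℝ (Fin 3)), ContDiff ℝ 2 w → VectorCalculus.IsDivFree w →
      ∀ (y : EuclideanSpace ℝ (Fin 3)) (j : Fin 3), (Laplacian.laplacian w y) j =
        ∑ i : Fin 3, fderiv ℝ (fun z => (fderiv ℝ w z (EuclideanSpace.single i (1 : ℝ))) j -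
          (fderiv ℝ w z (EuclideanSpace.single j (1 : ℝ))) i) y (EuclideanSpace.single i (1 : ℝ))) ∧
    (∀ (w : EuclideanSpace ℝ (Fin 3) → EuclideanSpace ℝ (Fin 3)), ContDiff ℝ 2 w →
      ∀ (l m j : Fin 3) (y : EuclideanSpace ℝ (Fin 3)),
        fderiv ℝ (fun z => (fderiv ℝ w z (EuclideanSpace.single m (1 : ℝ))) j -
            (fderiv ℝ w z (EuclideanSpace.single j (1 : ℝ))) m) y (EuclideanSpace.single l (1 : ℝ)) +
          fderiv ℝ (fun z => (fderiv ℝ w z (EuclideanSpace.single j (1 : ℝ))) l -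
            (fderiv ℝ w z (EuclideanSpace.single l (1 : ℝ))) j) y (EuclideanSpace.single m (1 : ℝ)) +
          fderiv ℝ (fun z => (fderiv ℝ w z (EuclideanSpace.single l (1 : ℝ))) m -
            (fderiv ℝ w z (EuclideanSpace.single m (1 : ℝ))) l) y (EuclideanSpace.single j (1 : ℝ)) = 0) ∧
    (∀ (w : EuclideanSpace ℝ (Fin 3) → EuclideanSpace ℝ (Fin 3)), ContDiff ℝ (⊤ : ℕ∞) w →
      VectorCalculus.IsDivFree w → ∀ (n : ℕ) (y : EuclideanSpace ℝ (Fin 3)),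
      ‖iteratedFDeriv ℝ n (Laplacian.laplacian w) y‖ ≤ ∑ j : Fin 3, ∑ i : Fin 3,
        ‖iteratedFDeriv ℝ (n + 1) (fun z => (fderiv ℝ w z (EuclideanSpace.single i (1 : ℝ))) j -
          (fderiv ℝ w z (EuclideanSpace.single j (1 : ℝ))) i) y‖) :=
  ⟨fun _w hw hdiv y j => laplacian_coord_eq_sum_fderiv_antisymGrad hw hdiv y j,
    fun _w hw l m j y => antisymGrad_cyclic hw l m j y,
    fun _w hw hdiv n y => norm_iteratedFDeriv_laplacian_le_sum hw hdiv n y⟩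

end Summit.NavierStokesRegularity.NavierStokesRegularity.Theorems.RellichScarScarRigidity

end
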